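import Summits.QuantumFields.YangMills.Theses.ConvexGribovBody
import Literature.MathematicalPhysics.QuantumFieldTheory.LatticeGaugeProofs
import Summits.QuantumFields.YangMills.Theorems.ConvexGribovBodyPoincareToGapCovLogConvex
import Summits.QuantumFields.YangMills.Theorems.ConvexGribovBodyBrascampLiebVacuumStubRpHankel

/-!
# Reflection positivity in Cauchy–Schwarz form for two layer observables
(crux `ConvexGribovBody.PoincareToGap`, line `Sketch`, stub G1 `stub_crossCov_sq_le`)

On the odd torus `(ℤ/(2S+1))⁴`, `S ≥ 1`, with Wilson's measure `μ = wilsonMeasure r.ρ β`, `β ≥ 0`,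
let `A, B` be bounded measurable observables reading only the SPATIAL links of the time-zero
slice, `T_v := torusConfigShift v`, `mA := ∫ A dμ`, `mB := ∫ B dμ`,
`X(n) := ∫ A · (B ∘ T_{n e₀}) dμ - mA mB`, `cA(n) := ∫ A · (A ∘ T_{n e₀}) dμ - mA²`, `cB` likewise.
For residues `s, t` with `1 ≤ s.val, t.val ≤ S + 1` we prove
`(X(1-s-t) + X(s+t-1))² ≤ 4 cA(1-2s) cB(1-2t)`.

Proof. Put `FA_t := A ∘ T_{-t e₀} - mA`, `FB_t := B ∘ T_{-t e₀} - mB` (centred copies living on the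
spatial links of the slice `t`). Wave 0's reflection `θ t = 1 - t` gives `FA_t ∘ Θ = FA_{1-t}`
(`covLC_layer_timeReflect`), the copies read `oPosEdges ∪ oSharedEdges` for `1 ≤ t ≤ S + 1`
(`covLC_layer_dependsOn`), and stationarity (`covLC_integral_comp_shift_mul_comp_shift`) evaluates
`∫ FA_s FB_t dμ = X(s - t)`, `∫ FA_s FA_t dμ = cA(s - t)`, `∫ FB_s FB_t dμ = cB(s - t)`.
Reflection positivity of the odd torus (`covLC_integral_timeReflect_mul_self_nonneg`, i.e.
`wilsonExpectation_oddReflectionPositive`) applied to the real combination `a FA_s + b FB_t` yields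
`0 ≤ a² cA(1-2s) + ab (X(1-s-t) + X(s+t-1)) + b² cB(1-2t)` for all real `a, b`; the `2 × 2`
discriminant (`covLC_sq_le_mul`) is the claim. The cross term appears symmetrised because the two
pairings `⟨ΘFA · FB⟩`, `⟨ΘFB · FA⟩` are `X(1-s-t)` and `X(s+t-1)`.
References: K. Osterwalder, E. Seiler, Ann. Phys. 110 (1978) 440, §2; E. Seiler, LNP 159 (1982),
Ch. 2; J. Fröhlich, R. Israel, E. Lieb, B. Simon, Comm. Math. Phys. 62 (1978) 1. [folklore]
-/

noncomputable section

open scoped BigOperators Topology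
open MeasureTheory Filter
open Literature.MathematicalPhysics.QuantumFieldTheory

namespace Summit.QuantumFields.YangMills.Theorems.PoincareToGap

/-- From `0 ≤ a² p + a b X₁ + a b X₂ + b² r` for all real `a, b` one gets `(X₁ + X₂)² ≤ 4 p r`
(the discriminant of a non-negative binary quadratic form). [folklore] -/
theorem crossCov_sq_le_four_mul {p r X₁ X₂ : ℝ}
    (h : ∀ a b : ℝ, 0 ≤ a ^ 2 * p + a * b * X₁ + a * b * X₂ + b ^ 2 * r) :
    (X₁ + X₂) ^ 2 ≤ 4 * p * r := by
  have hq : ((X₁ + X₂) / 2) ^ 2 ≤ p * r := covLC_sq_le_mul fun a b => by linarith [h a b]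
  linarith [hq]

section Stationarity

variable {d L N : ℕ} [NeZero L] {G : Type*} [Group G] [TopologicalSpace G] [IsTopologicalGroup G]
  [CompactSpace G] [MeasurableSpace G] [BorelSpace G] (ρ : G →* Matrix (Fin N) (Fin N) ℂ) (β : ℝ)
  {μ : Measure (GaugeConfig d L G)}

/-- Cross-covariance of translated copies of two bounded observables in terms of the two-point
function: `∫ (A ∘ T_v - mA)(B ∘ T_w - mB) dμ = ∫ A (B ∘ T_{w-v}) dμ - mA mB` for `mA = ∫ A dμ`,
`mB = ∫ B dμ` (translation invariance of Wilson's measure). [folklore] -/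
theorem crossCov_integral_centred_mul_centred (hμ : μ = wilsonMeasure ρ β) (hρ : Continuous ρ)
    (A B : GaugeConfig d L G → ℝ) (hAm : Measurable A) (hBm : Measurable B) {MA MB : ℝ}
    (hMA : ∀ U, |A U| ≤ MA) (hMB : ∀ U, |B U| ≤ MB) (mA mB : ℝ) (hmA : ∫ V, A V ∂μ = mA)
    (hmB : ∫ V, B V ∂μ = mB) (v w : Site d L) :
    ∫ U, (A (torusConfigShift v U) - mA) * (B (torusConfigShift w U) - mB) ∂μ =
      ∫ U, A U * B (torusConfigShift (w - v) U) ∂μ - mA * mB := by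
  haveI : IsProbabilityMeasure μ := hμ ▸ isProbabilityMeasure_wilsonMeasure (d := d) (L := L) ρ hρ β
  have hX : ∫ U, A (torusConfigShift v U) ∂μ = mA :=
    (covLC_integral_comp_shift ρ β hμ v A).trans hmA
  have hY : ∫ U, B (torusConfigShift w U) ∂μ = mB :=
    (covLC_integral_comp_shift ρ β hμ w B).trans hmB
  have mX : MemLp (fun U => A (torusConfigShift v U)) 2 μ :=
    MemLp.of_bound (hAm.comp (torusConfigShift v).measurable).aestronglyMeasurable MA
      (ae_of_all _ fun U => by rw [Real.norm_eq_abs]; exact hMA _)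
  have mY : MemLp (fun U => B (torusConfigShift w U)) 2 μ :=
    MemLp.of_bound (hBm.comp (torusConfigShift w).measurable).aestronglyMeasurable MB
      (ae_of_all _ fun U => by rw [Real.norm_eq_abs]; exact hMB _)
  have h := ProbabilityTheory.covariance_eq_sub mX mY
  simp only [ProbabilityTheory.covariance, hX, hY, Pi.mul_apply] at h
  rw [h, covLC_integral_comp_shift_mul_comp_shift ρ β hμ]

end Stationarity

/-- G1 `stub_crossCov_sq_le` — **reflection positivity, Cauchy–Schwarz form, for two layer
observables.** For `0 ≤ β`, `S ≥ 1`, `μ` Wilson's measure on the torus `(ℤ/(2S+1))⁴`, bounded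
measurable `A, B` reading only time-zero SPATIAL links and residues `s, t` with
`1 ≤ s.val, t.val ≤ S + 1`: with `X(n) := ∫ A · (B ∘ T_{n e₀}) dμ - (∫ A)(∫ B)` and the
autocovariances `cA, cB`, `(X(1-s-t) + X(s+t-1))² ≤ 4 cA(1-2s) cB(1-2t)`. Reflection positivity of
the odd torus (`covLC_integral_timeReflect_mul_self_nonneg`) for `a (A ∘ T_{-s e₀} - ∫ A) +
b (B ∘ T_{-t e₀} - ∫ B)`, the reflection of layer copies (`covLC_layer_timeReflect`), stationarity
(`crossCov_integral_centred_mul_centred`) and the discriminant (`crossCov_sq_le_four_mul`).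
[folklore] -/
theorem stub_crossCov_sq_le :
    ∀ (G : Type) [Group G] [TopologicalSpace G] [IsTopologicalGroup G] [CompactSpace G]
      [MeasurableSpace G] [BorelSpace G] (r : LatticeRep G) (β : ℝ), 0 ≤ β → ∀ S : ℕ, 1 ≤ S →
    ∀ μ : Measure (GaugeConfig 4 (2 * S + 1) G),
      μ = (wilsonMeasure r.ρ β : Measure (GaugeConfig 4 (2 * S + 1) G)) →
    ∀ A B : GaugeConfig 4 (2 * S + 1) G → ℝ, Measurable A → Measurable B →
      (∃ M : ℝ, ∀ U, |A U| ≤ M) → (∃ M : ℝ, ∀ U, |B U| ≤ M) →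
      DependsOn A {e : Edge 4 (2 * S + 1) | e.1 0 = 0 ∧ e.2 ≠ 0} →
      DependsOn B {e : Edge 4 (2 * S + 1) | e.1 0 = 0 ∧ e.2 ≠ 0} →
    ∀ s t : ZMod (2 * S + 1), 1 ≤ s.val → s.val ≤ S + 1 → 1 ≤ t.val → t.val ≤ S + 1 →
      ((∫ U, A U * B (torusConfigShift (Pi.single (0 : Fin 4) (1 - s - t) : Site 4 (2 * S + 1)) U) ∂μ -
          (∫ U, A U ∂μ) * ∫ U, B U ∂μ) +
        (∫ U, A U * B (torusConfigShift (Pi.single (0 : Fin 4) (s + t - 1) : Site 4 (2 * S + 1)) U) ∂μ -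
          (∫ U, A U ∂μ) * ∫ U, B U ∂μ)) ^ 2 ≤
        4 * (∫ U, A U * A (torusConfigShift (Pi.single (0 : Fin 4) (1 - 2 * s) : Site 4 (2 * S + 1)) U) ∂μ -
            (∫ U, A U ∂μ) * ∫ U, A U ∂μ) *
          (∫ U, B U * B (torusConfigShift (Pi.single (0 : Fin 4) (1 - 2 * t) : Site 4 (2 * S + 1)) U) ∂μ -
            (∫ U, B U ∂μ) * ∫ U, B U ∂μ) := by
  intro G _ _ _ _ _ _ r β hβ S _hS μ hμ A B hAm hBm hAb hBb hAd hBd s t hs hs' ht ht'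
  obtain ⟨MA, hMA⟩ := hAb
  obtain ⟨MB, hMB⟩ := hBb
  haveI : IsProbabilityMeasure μ :=
    hμ ▸ isProbabilityMeasure_wilsonMeasure (d := 4) (L := 2 * S + 1) r.ρ r.continuous β
  have hL : Odd (2 * S + 1) := odd_two_mul_add_one S
  have hL3 : 3 ≤ 2 * S + 1 := by omega
  have hs2 : s.val ≤ (2 * S + 1) / 2 + 1 := by omega
  have ht2 : t.val ≤ (2 * S + 1) / 2 + 1 := by omega
  set mA : ℝ := ∫ U, A U ∂μ with hmA
  set mB : ℝ := ∫ U, B U ∂μ with hmB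
  -- the centred layer copies of `A` and `B` on the spatial links of the slice `t'`
  set FA : ZMod (2 * S + 1) → GaugeConfig 4 (2 * S + 1) G → ℝ := fun t' U =>
    A (torusConfigShift (Pi.single (0 : Fin 4) (-t') : Site 4 (2 * S + 1)) U) - mA with hFA
  set FB : ZMod (2 * S + 1) → GaugeConfig 4 (2 * S + 1) G → ℝ := fun t' U =>
    B (torusConfigShift (Pi.single (0 : Fin 4) (-t') : Site 4 (2 * S + 1)) U) - mB with hFB
  have hFAm : ∀ t', Measurable (FA t') := fun t' =>
    (hAm.comp (torusConfigShift
      (Pi.single (0 : Fin 4) (-t') : Site 4 (2 * S + 1))).measurable).sub_const mA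
  have hFBm : ∀ t', Measurable (FB t') := fun t' =>
    (hBm.comp (torusConfigShift
      (Pi.single (0 : Fin 4) (-t') : Site 4 (2 * S + 1))).measurable).sub_const mB
  have hFAb : ∀ t' U, |FA t' U| ≤ MA + |mA| := fun t' U =>
    (abs_sub _ _).trans (add_le_add (hMA _) le_rfl)
  have hFBb : ∀ t' U, |FB t' U| ≤ MB + |mB| := fun t' U =>
    (abs_sub _ _).trans (add_le_add (hMB _) le_rfl)
  -- reflection `θ t = 1 - t` of the layer copies
  have hreflA : ∀ t' U, FA t' U.timeReflect = FA (1 - t') U := fun t' U => by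
    simp only [hFA]; rw [covLC_layer_timeReflect hAd t' U]
  have hreflB : ∀ t' U, FB t' U.timeReflect = FB (1 - t') U := fun t' U => by
    simp only [hFB]; rw [covLC_layer_timeReflect hBd t' U]
  -- the copies on the slices `s`, `t` read only positive-time or shared links
  have hdepA : DependsOn (FA s) ((WilsonOddRP.oPosEdges ∪ WilsonOddRP.oSharedEdges :
      Finset (Edge 4 (2 * S + 1))) : Set (Edge 4 (2 * S + 1))) :=
    fun U V hUV => congrArg (fun x : ℝ => x - mA) (covLC_layer_dependsOn hAd hs hs2 hUV)
  have hdepB : DependsOn (FB t) ((WilsonOddRP.oPosEdges ∪ WilsonOddRP.oSharedEdges :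
      Finset (Edge 4 (2 * S + 1))) : Set (Edge 4 (2 * S + 1))) :=
    fun U V hUV => congrArg (fun x : ℝ => x - mB) (covLC_layer_dependsOn hBd ht ht2 hUV)
  -- integrability of the four pairings (`BrascampLiebVacuum.rpHankel_integrable_mul`)
  have hintAA : ∀ s' t', Integrable (fun U => FA s' U * FA t' U) μ := fun s' t' =>
    BrascampLiebVacuum.rpHankel_integrable_mul (hFAm s') (hFAm t') (hFAb s') (hFAb t')
  have hintAB : ∀ s' t', Integrable (fun U => FA s' U * FB t' U) μ := fun s' t' =>
    BrascampLiebVacuum.rpHankel_integrable_mul (hFAm s') (hFBm t') (hFAb s') (hFBb t')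
  have hintBA : ∀ s' t', Integrable (fun U => FB s' U * FA t' U) μ := fun s' t' =>
    BrascampLiebVacuum.rpHankel_integrable_mul (hFBm s') (hFAm t') (hFBb s') (hFAb t')
  have hintBB : ∀ s' t', Integrable (fun U => FB s' U * FB t' U) μ := fun s' t' =>
    BrascampLiebVacuum.rpHankel_integrable_mul (hFBm s') (hFBm t') (hFBb s') (hFBb t')
  -- stationarity: the four pairings as two-point functions
  have hAA : ∀ s' t' : ZMod (2 * S + 1), ∫ U, FA s' U * FA t' U ∂μ =
      ∫ U, A U * A (torusConfigShift (Pi.single (0 : Fin 4) (s' - t') : Site 4 (2 * S + 1)) U) ∂μ -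
        mA * mA := fun s' t' => by
    simp only [hFA]
    rw [crossCov_integral_centred_mul_centred r.ρ β hμ r.continuous A A hAm hAm hMA hMA mA mA
      hmA.symm hmA.symm, ← Pi.single_sub, neg_sub_neg]
  have hAB : ∀ s' t' : ZMod (2 * S + 1), ∫ U, FA s' U * FB t' U ∂μ =
      ∫ U, A U * B (torusConfigShift (Pi.single (0 : Fin 4) (s' - t') : Site 4 (2 * S + 1)) U) ∂μ -
        mA * mB := fun s' t' => by
    simp only [hFA, hFB]
    rw [crossCov_integral_centred_mul_centred r.ρ β hμ r.continuous A B hAm hBm hMA hMB mA mB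
      hmA.symm hmB.symm, ← Pi.single_sub, neg_sub_neg]
  have hBA : ∀ s' t' : ZMod (2 * S + 1), ∫ U, FB s' U * FA t' U ∂μ =
      ∫ U, A U * B (torusConfigShift (Pi.single (0 : Fin 4) (t' - s') : Site 4 (2 * S + 1)) U) ∂μ -
        mA * mB := fun s' t' => by
    rw [← hAB t' s']
    congr 1; funext U; ring
  have hBB : ∀ s' t' : ZMod (2 * S + 1), ∫ U, FB s' U * FB t' U ∂μ =
      ∫ U, B U * B (torusConfigShift (Pi.single (0 : Fin 4) (s' - t') : Site 4 (2 * S + 1)) U) ∂μ -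
        mB * mB := fun s' t' => by
    simp only [hFB]
    rw [crossCov_integral_centred_mul_centred r.ρ β hμ r.continuous B B hBm hBm hMB hMB mB mB
      hmB.symm hmB.symm, ← Pi.single_sub, neg_sub_neg]
  -- index algebra on the odd cycle
  have e1 : (1 : ZMod (2 * S + 1)) - s - s = 1 - 2 * s := by ring
  have e2 : s - ((1 : ZMod (2 * S + 1)) - t) = s + t - 1 := by ring
  have e3 : (1 : ZMod (2 * S + 1)) - t - t = 1 - 2 * t := by ring
  -- reflection positivity for `a FA_s + b FB_t`, expanded
  refine crossCov_sq_le_four_mul fun a b => ?_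
  have h0 := covLC_integral_timeReflect_mul_self_nonneg r.ρ hL hL3 r.continuous hβ hμ
    (fun U => a * FA s U + b * FB t U) (((hFAm s).const_mul a).add ((hFBm t).const_mul b))
    ⟨|a| * (MA + |mA|) + |b| * (MB + |mB|), fun U => (abs_add_le _ _).trans (add_le_add
      (by rw [abs_mul]; exact mul_le_mul_of_nonneg_left (hFAb s U) (abs_nonneg a))
      (by rw [abs_mul]; exact mul_le_mul_of_nonneg_left (hFBb t U) (abs_nonneg b)))⟩
    (fun U V hUV => by
      show a * FA s U + b * FB t U = a * FA s V + b * FB t V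
      rw [hdepA hUV, hdepB hUV])
  simp only [hreflA, hreflB] at h0
  rw [covLC_integral_lin_mul_lin (hintAA _ _) (hintAB _ _) (hintBA _ _) (hintBB _ _), hAA, hAB,
    hBA, hBB, e1, e2, e3] at h0
  exact h0

end Summit.QuantumFields.YangMills.Theorems.PoincareToGap

end
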